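import Summits.QuantumFields.YangMills.Theorems.LuscherReductionTwistedTraceScalingBTCoreWeight
import HarnessLib

/-!
# The Faddeev–Popov weights of record are INVERSION SYMMETRIC: `fpWeight ε g⁻¹ = fpWeight ε g`, `coreWeight ε R₁ g⁻¹ = coreWeight ε R₁ g`, `tailWeight ε R₁ g⁻¹ = tailWeight ε R₁ g`
# (route `FlatTubeReduction`, crux K1 `NearFlatRatioLaw` stmt-QuantumFields-24720; seat `ym-line-ftr-p1` g15; rate twin «ratepack-v3 / frozen fibres»; R2b1 RECORD rung — no summit
# statement is proved here)

WHY (PICKED.md g15; `…SymmetricNearPair`).  The symmetric near-pair ratio `fpBOKernel_near_dressed` uses the involution `(v,v',g) ↦ (v',v,g⁻¹)` of fibre × fibre × gauge group and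
therefore needs the gauge weight `W` to satisfy `W(g⁻¹) = W(g)`.  Lane A's weights (`…BTColourMean.fpWeight` = indicator that the polar colour mean of `g` is `ε`-close to `1`;
`…BTCoreWeight.coreWeight/tailWeight` = its restriction to/off the jump core `{‖q(g_y) − q(g_x)‖ < R₁}`) have this property: the colour sum of `g⁻¹` is the quaternionic conjugate of
that of `g`, conjugation commutes with the polar part and preserves `‖· − 1‖`, and the jumps of `g⁻¹` are the conjugates of the jumps of `g`.
* `colourQuatSum_inv`, `norm_su2Quat_colourMean_inv_sub_one`, ★ `fpWeight_inv`; `inv_mem_coreSet_iff`, ★ `coreWeight_inv`, `tailWeight_inv`.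
HONEST FRAMING: bookkeeping for a stub of the CONDITIONAL reduction route R2b1; femto rung R2b1 (RECORD label); not infinite volume, not a gap, not Clay.  No defs, no named facts, no `sorry`.
-/

set_option autoImplicit false

noncomputable section

open MeasureTheory Filter Topology Real
open scoped BigOperators Quaternion
open Literature.MathematicalPhysics.QuantumFieldTheory
open Literature.MathematicalPhysics.QuantumLattice

namespace Summit.QuantumFields.YangMills.Theorems.FemtoTransferGap.TwoLattice.ConstTube

open Summit.QuantumFields.YangMills.Theorems.FemtoTransferGap
open Summit.QuantumFields.YangMills.Theorems.FemtoTransferGap.TwoLattice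
open Literature.MathematicalPhysics.QuantumFieldTheory.Balaban1983to89.T4WilsonLinkAffine (su2Quat_inv)
open Literature.MathematicalPhysics.QuantumFieldTheory.Balaban1983to89.T4HaarSU2Translate (su2Quat_quatToSU2)

variable {L : ℕ} [NeZero L]

/-! ## §1 The colour mean of `g⁻¹` -/

/-- The colour sum of `g⁻¹` is the conjugate of the colour sum of `g`. [folklore] -/
theorem colourQuatSum_inv (g : Site 3 L → SU2) : colourQuatSum L g⁻¹ = star (colourQuatSum L g) := by
  unfold colourQuatSum
  rw [star_sum]
  exact Finset.sum_congr rfl fun x _ => by rw [Pi.inv_apply, su2Quat_inv]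

omit [NeZero L] in
/-- `‖star q − 1‖ = ‖q − 1‖`. [folklore] -/
theorem norm_star_sub_one (q : ℍ) : ‖star q - 1‖ = ‖q - 1‖ := by
  rw [← norm_star (q - 1), star_sub, star_one]

/-- `‖q(colourMean g⁻¹) − 1‖ = ‖q(colourMean g) − 1‖`. [folklore] -/
theorem norm_su2Quat_colourMean_inv_sub_one (g : Site 3 L → SU2) : ‖su2Quat (colourMean L g⁻¹) - 1‖ = ‖su2Quat (colourMean L g) - 1‖ := by
  unfold colourMean
  rw [colourQuatSum_inv]
  by_cases h : colourQuatSum L g = 0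
  · rw [if_pos h, if_pos (by rw [h, star_zero]), Pi.inv_apply, su2Quat_inv, norm_star_sub_one]
  · have hs : star (colourQuatSum L g) ≠ 0 := fun h' => h (by rw [← star_star (colourQuatSum L g), h', star_zero])
    rw [if_neg h, if_neg hs, su2Quat_quatToSU2 h, su2Quat_quatToSU2 hs, norm_star]
    have e : ‖colourQuatSum L g‖⁻¹ • star (colourQuatSum L g) = star (‖colourQuatSum L g‖⁻¹ • colourQuatSum L g) := by
      rw [← Quaternion.coe_mul_eq_smul, ← Quaternion.coe_mul_eq_smul, star_mul, Quaternion.star_coe, Quaternion.coe_commutes]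
    rw [e, norm_star_sub_one]

/-- ★ **The FP weight of record is inversion symmetric**: `fpWeight ε g⁻¹ = fpWeight ε g`. [folklore] -/
theorem fpWeight_inv (ε : ℝ) (g : Site 3 L → SU2) : fpWeight L ε g⁻¹ = fpWeight L ε g := by
  unfold fpWeight
  have hiff : colourMean L g⁻¹ ∈ fpBall ε ↔ colourMean L g ∈ fpBall ε := by
    unfold fpBall; simp only [Set.mem_setOf_eq, norm_su2Quat_colourMean_inv_sub_one]
  by_cases h : colourMean L g ∈ fpBall ε
  · rw [Set.indicator_of_mem h, Set.indicator_of_mem (hiff.mpr h)]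
  · rw [Set.indicator_of_notMem h, Set.indicator_of_notMem (fun h' => h (hiff.mp h'))]

/-! ## §2 The jump core of `g⁻¹` -/

omit [NeZero L] in
/-- `g⁻¹ ∈ coreSet R₁ ↔ g ∈ coreSet R₁` (the jumps of `g⁻¹` are the conjugates of those of `g`). [folklore] -/
theorem inv_mem_coreSet_iff (R₁ : ℝ) (g : Site 3 L → SU2) : g⁻¹ ∈ coreSet L R₁ ↔ g ∈ coreSet L R₁ := by
  unfold coreSet
  simp only [Set.mem_setOf_eq, Pi.inv_apply, su2Quat_inv, ← star_sub, norm_star]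

/-- ★ **The core weight is inversion symmetric**: `coreWeight ε R₁ g⁻¹ = coreWeight ε R₁ g`. [folklore] -/
theorem coreWeight_inv (ε R₁ : ℝ) (g : Site 3 L → SU2) : coreWeight L ε R₁ g⁻¹ = coreWeight L ε R₁ g := by
  unfold coreWeight
  by_cases h : g ∈ coreSet L R₁
  · rw [Set.indicator_of_mem h, Set.indicator_of_mem ((inv_mem_coreSet_iff R₁ g).mpr h), fpWeight_inv]
  · rw [Set.indicator_of_notMem h, Set.indicator_of_notMem (fun h' => h ((inv_mem_coreSet_iff R₁ g).mp h'))]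

/-- The tail weight is inversion symmetric: `tailWeight ε R₁ g⁻¹ = tailWeight ε R₁ g`. [folklore] -/
theorem tailWeight_inv (ε R₁ : ℝ) (g : Site 3 L → SU2) : tailWeight L ε R₁ g⁻¹ = tailWeight L ε R₁ g := by
  unfold tailWeight
  by_cases h : g ∈ (coreSet L R₁)ᶜ
  · have h' : g⁻¹ ∈ (coreSet L R₁)ᶜ := fun hc => h ((inv_mem_coreSet_iff R₁ g).mp hc)
    rw [Set.indicator_of_mem h, Set.indicator_of_mem h', fpWeight_inv]
  · have h' : g⁻¹ ∉ (coreSet L R₁)ᶜ := fun hc => h (fun hg => hc ((inv_mem_coreSet_iff R₁ g).mpr hg))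
    rw [Set.indicator_of_notMem h, Set.indicator_of_notMem h']

end Summit.QuantumFields.YangMills.Theorems.FemtoTransferGap.TwoLattice.ConstTube

end
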